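import Literature.MathematicalPhysics.QuantumLattice.GrassmannGaussianChargeRule
import HarnessLib

/-!
# Linear symmetries of Gaussian Grassmann integrations (BGM 2006, §2.1, symmetries (1)–(4))

Trunk **QLatticeAQFT**; companion of `GrassmannIntegralSubstitution.lean` (`berezin_map`: a linear
substitution of the generators multiplies the Berezin integral by its Jacobian) and
`GrassmannGaussianChargeRule.lean`.  Benfatto–Giuliani–Mastropietro 2006, §2.1 (arXiv p. 6) list
the symmetries of the Gaussian integration `P(dψ)` and of the interaction used to constrain the
renormalisation-group flow: (1) spin exchange, (2) global `U(1)`, (3) global `SO(2)` spin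
rotations, (4) parity, (5) complex conjugation.  (1)–(4) are *block substitutions*
`ψ̄ᵢ ↦ Σₖ S_{ki} ψ̄ₖ`, `ψⱼ ↦ Σₗ T_{lj} ψₗ` of the fermion generators; this file proves the general
transformation rule of the Gaussian Berezin integral under such substitutions and the resulting
invariance statements ((5) is antilinear and is not treated).

## Main results

* `blockSubst R S T` (a `def`: the endomorphism of the generator space `ι ⊕ₗ ι → R`) with
  `blockSubst_apply`, `blockSubst_single_inl/inr`, `map_blockSubst_psiBar` (`ψ̄ᵢ ↦ Σₖ S k i ψ̄ₖ`),
  `map_blockSubst_psi` (`ψⱼ ↦ Σₗ T l j ψₗ`);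
* `map_blockSubst_quadratic` — **the action transforms by congruence**,
  `(ψ̄Aψ) ∘ blockSubst S T = ψ̄ (S A Tᵀ) ψ`; `map_blockSubst_grassmannExp_quadratic`;
* `det_blockSubst` — the Jacobian is `det S · det T`;
* `berezin_grassmannExp_quadratic_mul_map_blockSubst` —
  `∫ e^{ψ̄(SATᵀ)ψ} (F ∘ blockSubst S T) = det S det T ∫ e^{ψ̄Aψ} F` for every `F`;
* `berezin_grassmannExp_quadratic_mul_map_blockSubst_of_invariant` — **invariance** of the Gaussian
  integration with action `ψ̄Aψ` under every block substitution with `S A Tᵀ = A`,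
  `det S det T = 1` (BGM (2) with `S = c⁻¹`, `T = c`; (3) with `S = T ∈ SO(2)` acting on the spin
  index of a spin-independent `A`);
* `berezin_grassmannExp_quadratic_mul_map_perm` — the permutation case `S = T = P_σ` with
  `A (σ i) (σ j) = A i j` (BGM (1) spin exchange, (4) lattice parity).

## Sources

G. Benfatto, A. Giuliani, V. Mastropietro, Ann. Henri Poincaré 7 (2006) 809–898, §2.1 (arXiv p. 6
of the held copy `paper:arxiv-cond-mat_0507686`): "Note that both the Gaussian integration `P(dψ)`
and the interaction `V(ψ)` are invariant under the action of the following symmetry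
transformations: (1) spin exchange: `ψ^ε_{x,↑} ↔ ψ^ε_{x,↓}`; (2) global `U(1)`:
`ψ^±_{x,σ} → e^{±iα_σ}ψ^±_{x,σ}` …; (3) global `SO(2)`: … ; (4) parity:
`ψ^±_{(x₀,x⃗),σ} → ψ^±_{(x₀,-x⃗),σ}`; (5) complex conjugation …"; bib key
`BenfattoGiulianiMastropietro2006`.
F. A. Berezin, *The Method of Second Quantization* (1966), Ch. I §3 (linear changes of variables in
the integral over a Grassmann algebra), as in `GrassmannIntegralSubstitution.lean`.
-/

noncomputable section

namespace Literature.MathematicalPhysics.QuantumLattice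

section QLatticeAQFT

open ExteriorAlgebra GrassmannAlgebra
open scoped Matrix

variable (R : Type*) [CommRing R] {ι : Type*} [LinearOrder ι] [Fintype ι]

/-- The **block substitution** of the fermion generators by two matrices:
`ψ̄ᵢ ↦ Σₖ S k i ψ̄ₖ`, `ψⱼ ↦ Σₗ T l j ψₗ` (as an endomorphism of the generator space `ι ⊕ₗ ι → R`);
e.g. spin exchange / lattice parity (`S = T` a permutation matrix), spin rotations (`S = T ∈ SO(2)`),
`U(1)` phases (`S = c⁻¹`, `T = c`) of BGM 2006, §2.1, symmetries (1)–(4). [folklore] -/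
def blockSubst (S T : Matrix ι ι R) : Module.End R (ι ⊕ₗ ι → R) :=
  ∑ i, (LinearMap.proj (toLex (Sum.inl i)) : (ι ⊕ₗ ι → R) →ₗ[R] R).smulRight
      (∑ k, S k i • (Pi.single (toLex (Sum.inl k)) (1 : R) : ι ⊕ₗ ι → R)) +
    ∑ j, (LinearMap.proj (toLex (Sum.inr j)) : (ι ⊕ₗ ι → R) →ₗ[R] R).smulRight
      (∑ l, T l j • (Pi.single (toLex (Sum.inr l)) (1 : R) : ι ⊕ₗ ι → R))

/-- Unfolding `blockSubst`. [folklore] -/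
theorem blockSubst_apply (S T : Matrix ι ι R) (w : ι ⊕ₗ ι → R) :
    blockSubst R S T w = ∑ i, w (toLex (Sum.inl i)) • ∑ k, S k i • (Pi.single (toLex (Sum.inl k)) (1 : R) : ι ⊕ₗ ι → R) +
      ∑ j, w (toLex (Sum.inr j)) • ∑ l, T l j • (Pi.single (toLex (Sum.inr l)) (1 : R) : ι ⊕ₗ ι → R) := by
  simp only [blockSubst, LinearMap.add_apply, LinearMap.sum_apply, LinearMap.smulRight_apply,
    LinearMap.proj_apply]

omit [LinearOrder ι] [Fintype ι] in
/-- Basis-vector bookkeeping on `ι ⊕ₗ ι`. [folklore] -/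
private theorem single_inl_apply_inl [DecidableEq ι] (i i' : ι) :
    (Pi.single (toLex (Sum.inl i)) (1 : R) : ι ⊕ₗ ι → R) (toLex (Sum.inl i')) = if i' = i then 1 else 0 := by
  simp only [Pi.single_apply, toLex_inj, Sum.inl.injEq]

omit [LinearOrder ι] [Fintype ι] in
/-- Basis-vector bookkeeping on `ι ⊕ₗ ι`. [folklore] -/
private theorem single_inr_apply_inr [DecidableEq ι] (j j' : ι) :
    (Pi.single (toLex (Sum.inr j)) (1 : R) : ι ⊕ₗ ι → R) (toLex (Sum.inr j')) = if j' = j then 1 else 0 := by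
  simp only [Pi.single_apply, toLex_inj, Sum.inr.injEq]

omit [LinearOrder ι] [Fintype ι] in
/-- Basis-vector bookkeeping on `ι ⊕ₗ ι`. [folklore] -/
private theorem single_inl_apply_inr [DecidableEq ι] (i j : ι) :
    (Pi.single (toLex (Sum.inl i)) (1 : R) : ι ⊕ₗ ι → R) (toLex (Sum.inr j)) = 0 :=
  Pi.single_eq_of_ne (fun h => by cases toLex_inj.1 h) _

omit [LinearOrder ι] [Fintype ι] in
/-- Basis-vector bookkeeping on `ι ⊕ₗ ι`. [folklore] -/
private theorem single_inr_apply_inl [DecidableEq ι] (j i : ι) :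
    (Pi.single (toLex (Sum.inr j)) (1 : R) : ι ⊕ₗ ι → R) (toLex (Sum.inl i)) = 0 :=
  Pi.single_eq_of_ne (fun h => by cases toLex_inj.1 h) _

/-- `blockSubst` on `ψ̄ᵢ`'s basis vector. [folklore] -/
theorem blockSubst_single_inl (S T : Matrix ι ι R) (i : ι) :
    blockSubst R S T (Pi.single (toLex (Sum.inl i)) 1) =
      ∑ k, S k i • (Pi.single (toLex (Sum.inl k)) (1 : R) : ι ⊕ₗ ι → R) := by
  rw [blockSubst_apply]
  simp only [single_inl_apply_inl, single_inl_apply_inr, ite_smul, one_smul, zero_smul,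
    Finset.sum_ite_eq', Finset.mem_univ, if_true, Finset.sum_const_zero, add_zero]

/-- `blockSubst` on `ψⱼ`'s basis vector. [folklore] -/
theorem blockSubst_single_inr (S T : Matrix ι ι R) (j : ι) :
    blockSubst R S T (Pi.single (toLex (Sum.inr j)) 1) =
      ∑ l, T l j • (Pi.single (toLex (Sum.inr l)) (1 : R) : ι ⊕ₗ ι → R) := by
  rw [blockSubst_apply]
  simp only [single_inr_apply_inr, single_inr_apply_inl, ite_smul, one_smul, zero_smul,
    Finset.sum_ite_eq', Finset.mem_univ, if_true, Finset.sum_const_zero, zero_add]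

/-- The block substitution on the fermion generators: `ψ̄ᵢ ↦ Σₖ S k i ψ̄ₖ`. [folklore] -/
theorem map_blockSubst_psiBar (S T : Matrix ι ι R) (i : ι) :
    ExteriorAlgebra.map (blockSubst R S T) (psiBar R i) = ∑ k, S k i • psiBar R k := by
  rw [psiBar, gen, ExteriorAlgebra.map_apply_ι, blockSubst_single_inl, map_sum]
  simp only [map_smul, psiBar, gen]

/-- … and `ψⱼ ↦ Σₗ T l j ψₗ`. [folklore] -/
theorem map_blockSubst_psi (S T : Matrix ι ι R) (j : ι) :
    ExteriorAlgebra.map (blockSubst R S T) (psi R j) = ∑ l, T l j • psi R l := by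
  rw [psi, gen, ExteriorAlgebra.map_apply_ι, blockSubst_single_inr, map_sum]
  simp only [map_smul, psi, gen]

omit [LinearOrder ι] in
/-- Reordering a fourfold sum. [folklore] -/
private theorem sum4_comm {M : Type*} [AddCommMonoid M] (f : ι → ι → ι → ι → M) :
    ∑ i, ∑ j, ∑ k, ∑ l, f i j k l = ∑ k, ∑ l, ∑ i, ∑ j, f i j k l :=
  calc ∑ i, ∑ j, ∑ k, ∑ l, f i j k l
      = ∑ i, ∑ k, ∑ j, ∑ l, f i j k l := Finset.sum_congr rfl fun _ _ => Finset.sum_comm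
    _ = ∑ k, ∑ i, ∑ j, ∑ l, f i j k l := Finset.sum_comm
    _ = ∑ k, ∑ i, ∑ l, ∑ j, f i j k l :=
        Finset.sum_congr rfl fun _ _ => Finset.sum_congr rfl fun _ _ => Finset.sum_comm
    _ = ∑ k, ∑ l, ∑ i, ∑ j, f i j k l := Finset.sum_congr rfl fun _ _ => Finset.sum_comm

/-- **The quadratic action transforms by congruence**:
`map (blockSubst S T) (ψ̄ A ψ) = ψ̄ (S A Tᵀ) ψ`. [folklore] -/
theorem map_blockSubst_quadratic (S T A : Matrix ι ι R) :
    ExteriorAlgebra.map (blockSubst R S T) (quadratic R A) = quadratic R (S * A * Tᵀ) := by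
  have hL : ExteriorAlgebra.map (blockSubst R S T) (quadratic R A) =
      ∑ i, ∑ j, ∑ k, ∑ l, (A i j * (S k i * T l j)) • (psiBar R k * psi R l) := by
    simp only [quadratic, map_sum, map_smul, map_mul, map_blockSubst_psiBar, map_blockSubst_psi,
      Finset.sum_mul_sum, smul_mul_smul_comm, Finset.smul_sum, smul_smul]
  rw [hL, sum4_comm, quadratic]
  refine Finset.sum_congr rfl fun k _ => Finset.sum_congr rfl fun l _ => ?_
  rw [← Finset.sum_congr rfl fun i _ => (Finset.sum_smul (s := Finset.univ)
      (f := fun j => A i j * (S k i * T l j)) (x := psiBar R k * psi R l)), ← Finset.sum_smul]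
  congr 1
  simp only [Matrix.mul_apply, Matrix.transpose_apply, Finset.sum_mul]
  rw [Finset.sum_comm]
  exact Finset.sum_congr rfl fun i _ => Finset.sum_congr rfl fun j _ => by ring

/-- The block substitution commutes with the exponential of the action. [folklore] -/
theorem map_blockSubst_grassmannExp_quadratic [Algebra ℚ R] (S T A : Matrix ι ι R) :
    ExteriorAlgebra.map (blockSubst R S T) (grassmannExp (quadratic R A)) =
      grassmannExp (quadratic R (S * A * Tᵀ)) := by
  rw [map_grassmannExp R _ (isNilpotent_quadratic R A), map_blockSubst_quadratic]

/-- **The Jacobian of the block substitution** is `det S · det T` (block-diagonal matrix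
`diag(S, T)` in the basis `ψ̄, ψ`). [folklore] -/
theorem det_blockSubst (S T : Matrix ι ι R) : LinearMap.det (blockSubst R S T) = S.det * T.det := by
  rw [← LinearMap.det_toMatrix', ← Matrix.det_submatrix_equiv_self (toLex : ι ⊕ ι ≃ ι ⊕ₗ ι)]
  have hM : (LinearMap.toMatrix' (blockSubst R S T)).submatrix toLex toLex = Matrix.fromBlocks S 0 0 T := by
    ext x y
    rcases x with k | l <;> rcases y with i | j
    · simp only [Matrix.submatrix_apply, LinearMap.toMatrix'_apply, blockSubst_single_inl,
        Finset.sum_apply, Pi.smul_apply, single_inl_apply_inl, smul_eq_mul, mul_ite, mul_one, mul_zero,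
        Finset.sum_ite_eq, Finset.mem_univ, if_true, Matrix.fromBlocks_apply₁₁]
    · simp only [Matrix.submatrix_apply, LinearMap.toMatrix'_apply, blockSubst_single_inr,
        Finset.sum_apply, Pi.smul_apply, single_inr_apply_inl, smul_zero, Finset.sum_const_zero,
        Matrix.fromBlocks_apply₁₂, Matrix.zero_apply]
    · simp only [Matrix.submatrix_apply, LinearMap.toMatrix'_apply, blockSubst_single_inl,
        Finset.sum_apply, Pi.smul_apply, single_inl_apply_inr, smul_zero, Finset.sum_const_zero,
        Matrix.fromBlocks_apply₂₁, Matrix.zero_apply]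
    · simp only [Matrix.submatrix_apply, LinearMap.toMatrix'_apply, blockSubst_single_inr,
        Finset.sum_apply, Pi.smul_apply, single_inr_apply_inr, smul_eq_mul, mul_ite, mul_one, mul_zero,
        Finset.sum_ite_eq, Finset.mem_univ, if_true, Matrix.fromBlocks_apply₂₂]
  rw [hM, Matrix.det_fromBlocks_zero₂₁]

variable [Algebra ℚ R]

/-- **Linear symmetries of the Gaussian Grassmann integration** (Benfatto–Giuliani–Mastropietro
2006, §2.1: "both the Gaussian integration `P(dψ)` and the interaction `V(ψ)` are invariant under …
(1) spin exchange …; (2) global `U(1)` …; (3) global `SO(2)` …; (4) parity …", all of which are block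
substitutions `ψ̄ ↦ ψ̄S`, `ψ ↦ Tψ`): for any matrices `S, T, A` and any element `F`,
`∫ dψ̄dψ e^{ψ̄(SATᵀ)ψ} · (F ∘ blockSubst S T) = det S det T · ∫ dψ̄dψ e^{ψ̄Aψ} F`.
In particular, if `S A Tᵀ = A` and `det S det T = 1` the Gaussian integration with action `ψ̄Aψ` is
invariant under the substitution (`berezin_grassmannExp_quadratic_mul_map_blockSubst_of_invariant`).
[cite: BenfattoGiulianiMastropietro2006, §2.1 symmetries (1)-(4)] -/
theorem berezin_grassmannExp_quadratic_mul_map_blockSubst (S T A : Matrix ι ι R)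
    (F : GrassmannAlgebra R (ι ⊕ₗ ι)) :
    berezin R (ι ⊕ₗ ι) (grassmannExp (quadratic R (S * A * Tᵀ)) *
        ExteriorAlgebra.map (blockSubst R S T) F) =
      (S.det * T.det) * berezin R (ι ⊕ₗ ι) (grassmannExp (quadratic R A) * F) := by
  rw [← map_blockSubst_grassmannExp_quadratic, ← map_mul, berezin_map, det_blockSubst]

/-- Invariance of the Gaussian Grassmann integration under a block substitution preserving the
action and of unit Jacobian (BGM 2006, §2.1, symmetries (1)–(4)).
[cite: BenfattoGiulianiMastropietro2006, §2.1 symmetries (1)-(4)] -/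
theorem berezin_grassmannExp_quadratic_mul_map_blockSubst_of_invariant (S T A : Matrix ι ι R)
    (hA : S * A * Tᵀ = A) (hdet : S.det * T.det = 1) (F : GrassmannAlgebra R (ι ⊕ₗ ι)) :
    berezin R (ι ⊕ₗ ι) (grassmannExp (quadratic R A) * ExteriorAlgebra.map (blockSubst R S T) F) =
      berezin R (ι ⊕ₗ ι) (grassmannExp (quadratic R A) * F) := by
  have h := berezin_grassmannExp_quadratic_mul_map_blockSubst R S T A F
  rwa [hA, hdet, one_mul] at h

/-- **Spin/site permutation symmetry** (BGM symmetries (1) spin exchange and (4) parity are of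
this form): for a permutation `σ` of the indices with `A (σ i) (σ j) = A i j`, the Gaussian
integration is invariant under `ψ̄ᵢ ↦ ψ̄_{σ i}`, `ψᵢ ↦ ψ_{σ i}`.
[cite: BenfattoGiulianiMastropietro2006, §2.1 symmetries (1),(4)] -/
theorem berezin_grassmannExp_quadratic_mul_map_perm (σ : Equiv.Perm ι) (A : Matrix ι ι R)
    (hA : ∀ i j, A (σ i) (σ j) = A i j) (F : GrassmannAlgebra R (ι ⊕ₗ ι)) :
    berezin R (ι ⊕ₗ ι) (grassmannExp (quadratic R A) *
        ExteriorAlgebra.map (blockSubst R (σ.toPEquiv.toMatrix : Matrix ι ι R) (σ.toPEquiv.toMatrix)) F) =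
      berezin R (ι ⊕ₗ ι) (grassmannExp (quadratic R A) * F) := by
  refine berezin_grassmannExp_quadratic_mul_map_blockSubst_of_invariant R _ _ A ?_ ?_ F
  · have h2 : ((σ.toPEquiv.toMatrix : Matrix ι ι R))ᵀ = (σ.symm.toPEquiv.toMatrix : Matrix ι ι R) := by
      rw [Equiv.toPEquiv_symm, PEquiv.toMatrix_symm]
    rw [PEquiv.toMatrix_toPEquiv_mul, h2, PEquiv.mul_toMatrix_toPEquiv]
    ext i j
    simp only [Matrix.submatrix_apply, id, Equiv.symm_symm, hA]
  · rw [Matrix.det_permutation, ← Int.cast_mul, ← Units.val_mul, Int.units_mul_self, Units.val_one,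
      Int.cast_one]

end QLatticeAQFT

end Literature.MathematicalPhysics.QuantumLattice
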